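/-
Copyright (c) 2026. All rights reserved.
Released under Apache 2.0 license as described in the file LICENSE.
-/
import Literature.Geometry.Kaehler.ComplexTorusQuaternionXSixOptimalOrdersPrimitiveVectors
import Literature.Geometry.Kaehler.ComplexTorusQuaternionXSixSpecialCyclesPrimitiveClassNumbers
import Literature.NumberTheory.Automorphic.BrandtTraceNonEmbedding
import HarnessLib

/-!
# Eichler's optimal-embedding count for `O₆ ⊂ B = (−1,3)_ℚ`:
# `#{[J] through γ : O_L(J) ∩ ℚ(γ) = B_f} = h(B_f) · m₂(B_f) · m₃(B_f)` and
# `P(m) = |L_prim(m)/O₆^×| = h(disc S_m) · m₂ · m₃` for every `m > 0`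

Fifth file (assembly) of the Eichler-count plan for the X₆ special cycles. For the maximal order `O₆` (one ideal
class) of the indefinite division algebra `B = (−1,3)_ℚ` (ramified exactly at `2, 3`: `…XSixRamification`) and ANY
`γ ∈ B` with `trd γ = t`, `nrd γ = n`, `t² < 4n`, the tree's local–global count
`Brandt.card_throughClass_optimalOrder_eq_of_isUnit` (Vignéras III.5.11, proof (1), for division algebras) gives,
for every order `B_f = ℤ[σ_f] ∋ γ` of `ℚ(γ)` (`f ∈ ellipticConductors t n`),

  `#{[J] ∈ ThroughClass O₆ γ : O_L(J) ∩ ℚ(γ) = B_f} = h(B_f) · ∏_{p ∈ S₀} m_p(B_f)`,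

with `S₀ = {2, 3} ∪ S₁` (`S₁` the finite exceptional set of (H0)); at `q ∤ 6` the matrix model of `(O₆)_q` gives
`m_q = 1` and (H1) (`…XSixRamification`), and at `p ∈ {2, 3}` (`B_p` a division algebra, `(O₆)_p = {nrd, trd ∈ ℤ_p}`)
the tree's ramified local count `Brandt.RamHyp.localEmbeddingNumber_eq` gives Eichler's
`m_p(B_f) = [B_f maximal at p] · (2 − ρ_p(t_f, n_f)) = [B_f maximal at p] · (1 − (B_f/p))` (= the tree's `brFactorRam p t n f`).

* §1 `ramHyp_maxOrderLattice_ordOf`, **`localEmbeddingNumber_maxOrderLattice_ordOf_eq_of_dvd_six`** (`m_p(B_f)` for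
  `p ∣ 6`) and its `ℚ`-form `= brFactorRam p t n f`.
* §2 **`card_throughClass_ordOf_eq_classNumber_mul`** (EICHLER'S FORMULA for `O₆`):
  `#{[J] : O_L(J) ∩ ℚ(γ) = B_f} = h(t_f² − 4n_f) · m₂(B_f) · m₃(B_f)`, and the `brFactorRam` form.
* §3 the EMBEDDING CRITERION (Vignéras III.3.8 for `B`): if `t² − 4n < 0` is a non-square in `ℚ₂` and in `ℚ₃` then
  some `y ∈ B` has `(trd, nrd) = (t, n)` (`exists_trace_norm_of_not_isSquare_two_three`); hence if `(t, n)` is NOT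
  realised in `B` then `m₂(B_f) · m₃(B_f) = 0` for every `f` (`brFactorRam_two_mul_three_eq_zero_of_forall`).
* §4 **`card_primitive_classes_eq_classNumber_mul_brFactorRam`**: for EVERY `m > 0`,
  `P(m) = |L_prim(m)/O₆^×| = h(disc S_m) · m₂(S_m) · m₃(S_m)`, `S_m = B_{f₁}` the order `ℤ[√−m]` (`m ≢ 3 mod 4`,
  disc `−4m`) resp. `ℤ[(1+√−m)/2]` (`m ≡ 3 mod 4`, disc `−m`) — by `…XSixOptimalOrdersPrimitiveVectors`
  (`#{[J] : O_L(J) ∩ ℚ(γ) = B_{f₁}} = P(m)` for a pure `γ` of norm `m`) when such a `γ` exists, and `0 = 0` by §3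
  otherwise; and §5 the all-`t` form **`card_unit_classes_eq_sum_classNumber_mul_brFactorRam`**:
  `|L(t)/O₆^×| = Σ_{c² ∣ t} h(disc S_{t/c²}) m₂ m₃` (with `…PrimitiveClassNumbers.card_unit_classes_eq_sum_primitive`),
  the index set of KRY (3.4.13) evaluated as in KRY (3.4.6) / Vignéras III.5.14.

## Sources

* M. Eichler, *Zur Zahlentheorie der Quaternionen-Algebren*, J. reine angew. Math. 195 (1955) 127–151, Satz 3–5
  (optimal embeddings, `∏_p (1 − {S/p})`). [cite: Eichler1955, Satz 3–5]
* M.-F. Vignéras, *Arithmétique des algèbres de quaternions*, LNM 800 (1980), Ch. II §3 (`m_p = 1 − (B/p)` for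
  `p ∣ d(H)`), Ch. III §3 Thm. 3.8, §5 Thm. 5.11, Cor. 5.12–5.14, Exercice 5.2. [cite: VignerasLNM800, Ch. III §5 Thm. 5.11, Cor. 5.12–5.14; Ch. III §3 Thm. 3.8; Ch. II §3]
* S. Kudla, M. Rapoport, T. Yang, *Modular Forms and Special Cycles on Shimura Curves* (2006), §3.4 (3.4.6),
  (3.4.13), Remark 3.4.7. [cite: KudlaRapoportYang2006, §3.4 (3.4.6), (3.4.13)]

## Scope (honest)

Theorems only — no definition, no named fact, no instance. The local factors are left in the tree's form
`brFactorRam p t n f = [fp ∉ conductors] · (2 − ρ_p(t_f, n_f))`; their Kronecker-symbol form `1 − χ_d(p)` is not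
spelled out here.
-/

set_option maxSynthPendingDepth 3

open Quaternion Function
open scoped Pointwise
open Literature.NumberTheory.Automorphic Literature.NumberTheory.Automorphic.Brandt
open Literature.NumberTheory.Automorphic.HeckeTraceFormulaGL2Level (ellipticConductors)
open NumberField IsDedekindDomain
open Literature.NumberTheory.QuadraticFields.Quadratic (BinQF.classNumber)

namespace Literature.Geometry.Kaehler.ComplexTorus.QuaternionType

/-! ## §1 The local data at `p ∣ 6`: `RamHyp` and `m_p(B_f)` -/

section Local

/-- A prime dividing `6` is `2` or `3`. [folklore] -/
private theorem eq_two_or_three_of_dvd_six₆₅ {q : ℕ} (hq : q.Prime) (hd : q ∣ 6) : q = 2 ∨ q = 3 := by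
  rcases (Nat.Prime.dvd_mul hq : q ∣ 2 * 3 ↔ _).mp hd with h | h
  · exact Or.inl ((Nat.prime_dvd_prime_iff_eq hq Nat.prime_two).mp h)
  · exact Or.inr ((Nat.prime_dvd_prime_iff_eq hq Nat.prime_three).mp h)

/-- `2, 3 ∈ P` and `q ∉ P` prime ⇒ `q ∤ 6`. [folklore] -/
private theorem not_dvd_six_of_not_mem₆₅ {P : Finset ℕ} (h2 : 2 ∈ P) (h3 : 3 ∈ P) {q : ℕ} (hq : q.Prime) (hqP : q ∉ P) :
    ¬ q ∣ 6 := by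
  intro hd
  rcases eq_two_or_three_of_dvd_six₆₅ hq hd with rfl | rfl
  · exact hqP h2
  · exact hqP h3

/-- **The hypotheses of the ramified local count hold for `O₆` at `p ∣ 6`** and the order `B_f = ℤ[σ_f] ∋ γ`:
`B_p` is a division algebra, `(O₆)_p = {nrd, trd ∈ ℤ_p}` (`…XSixRamification`), `σ_f = k/f + γ/f`,
`σ_f² = t_f σ_f − n_f`. [cite: VignerasLNM800, Ch. II §1 Lemme 1.5, §3; Ch. III §5 Exercice 5.2] -/
theorem ramHyp_maxOrderLattice_ordOf {p : ℕ} [Fact p.Prime] (hp6 : p ∣ 6) {γ : ℍ[ℚ,((-1 : ℤ) : ℚ),((3 : ℤ) : ℚ)]} {t : ℤ} {n : ℕ}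
    (Hg : GammaHyp γ t n) {f : ℕ} (hf : f ∈ ellipticConductors t n) :
    RamHyp p (Submodule.span ℤ (Set.range ![(⟨1/2, 1/2, 1/2, -1/2⟩ : ℍ[ℚ,((-1 : ℤ) : ℚ),((3 : ℤ) : ℚ)]), ⟨0, 1, 0, 0⟩, ⟨0, 0, 1, 0⟩, ⟨0, 0, 0, 1⟩])) γ (ordOf γ t n f) (σf γ t n f) ((shift t n : ℚ) / f) f (tOf t n f) (nOf t n f) := by
  haveI := isQuaternionAlgebra_neg_one_three
  exact
    { hdivp := forall_isUnit_scalarExtension_of_dvd_six hp6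
      hOZ := isZOrder_maxOrderLattice
      hOp := mem_localAt_maxOrderLattice_iff_of_dvd_six hp6
      hγ := Hg.hγ
      hB := Hg.isQuadOrder_ordOf hf
      hm := (pos_of_mem_ellipticConductors Hg.hlt hf).ne'
      hσ₀ := rfl
      hBσ := fun _ => mem_ordOf_iff
      hsq := Hg.σf_sq hf }

/-- **Eichler's local embedding number at `p ∈ {2, 3}`**: `m_p(B_f) = 0` if `B_f` is not maximal at `p` (`fp` a
conductor), and `m_p(B_f) = 2 − ρ_p(t_f, n_f) = 1 − (B_f/p)` otherwise (`2` if `p` is inert in `ℚ(γ)`, `1` if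
ramified, `0` if split). [cite: VignerasLNM800, Ch. II §3; Ch. III §5 Thm. 5.11 and Exercice 5.2] [cite: Eichler1955, Satz 5] -/
theorem localEmbeddingNumber_maxOrderLattice_ordOf_eq_of_dvd_six {p : ℕ} (hp : p.Prime) (hp6 : p ∣ 6) {γ : ℍ[ℚ,((-1 : ℤ) : ℚ),((3 : ℤ) : ℚ)]}
    {t : ℤ} {n : ℕ} (Hg : GammaHyp γ t n) {f : ℕ} (hf : f ∈ ellipticConductors t n) :
    localEmbeddingNumber (Submodule.span ℤ (Set.range ![(⟨1/2, 1/2, 1/2, -1/2⟩ : ℍ[ℚ,((-1 : ℤ) : ℚ),((3 : ℤ) : ℚ)]), ⟨0, 1, 0, 0⟩, ⟨0, 0, 1, 0⟩, ⟨0, 0, 0, 1⟩])) γ (ordOf γ t n f) p =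
      if f * p ∈ ellipticConductors t n then 0 else 2 - Brandt.rho p (tOf t n f) (nOf t n f) := by
  classical
  haveI := Fact.mk hp
  haveI := isQuaternionAlgebra_neg_one_three
  rw [(ramHyp_maxOrderLattice_ordOf hp6 Hg hf).localEmbeddingNumber_eq, card_filter_add_eq_rho hp.ne_zero]
  by_cases hc : f * p ∈ ellipticConductors t n
  · rw [if_pos ((nonmax_iff Hg.hlt hp hf).mpr hc), if_pos hc]
  · rw [if_neg (mt (nonmax_iff Hg.hlt hp hf).mp hc), if_neg hc]

/-- The same in the tree's `ℚ`-valued form: `m_p(B_f) = brFactorRam p t n f` for `p ∣ 6`.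
[cite: VignerasLNM800, Ch. II §3; Ch. III §5 Exercice 5.2] -/
theorem localEmbeddingNumber_maxOrderLattice_ordOf_eq_brFactorRam {p : ℕ} (hp : p.Prime) (hp6 : p ∣ 6) {γ : ℍ[ℚ,((-1 : ℤ) : ℚ),((3 : ℤ) : ℚ)]}
    {t : ℤ} {n : ℕ} (Hg : GammaHyp γ t n) {f : ℕ} (hf : f ∈ ellipticConductors t n) :
    (localEmbeddingNumber (Submodule.span ℤ (Set.range ![(⟨1/2, 1/2, 1/2, -1/2⟩ : ℍ[ℚ,((-1 : ℤ) : ℚ),((3 : ℤ) : ℚ)]), ⟨0, 1, 0, 0⟩, ⟨0, 0, 1, 0⟩, ⟨0, 0, 0, 1⟩])) γ (ordOf γ t n f) p : ℚ) = brFactorRam p t n f := by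
  rw [localEmbeddingNumber_maxOrderLattice_ordOf_eq_of_dvd_six hp hp6 Hg hf, brFactorRam]
  by_cases hc : f * p ∈ ellipticConductors t n
  · rw [if_pos hc, if_pos hc, Nat.cast_zero]
  · rw [if_neg hc, if_neg hc, Nat.cast_sub (rho_le_two hp _ _), Nat.cast_two]

end Local

/-! ## §2 Eichler's formula for `O₆`: `#{[J] : O_L(J) ∩ ℚ(γ) = B_f} = h(B_f) · m₂(B_f) · m₃(B_f)` -/

section Eichler

/-- **EICHLER'S OPTIMAL-EMBEDDING COUNT for the maximal order `O₆` of `B = (−1,3)_ℚ`**: for `γ ∈ B` with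
`trd γ = t`, `nrd γ = n`, `t² < 4n`, and every order `B_f = ℤ[σ_f] ∋ γ` of `ℚ(γ)`,
`#{[J] ∈ ThroughClass O₆ γ : O_L(J) ∩ ℚ(γ) = B_f} = h(t_f² − 4n_f) · m₂(B_f) · m₃(B_f)` — the number of classes
(mod `ℚ(γ)ˣ`) of right `O₆`-ideals through `γ` with optimal order `B_f`, i.e. (`h(O₆) = 1`) of `O₆^×`-classes of
optimal embeddings `B_f ↪ O₆`, is the class number of `B_f` times the local embedding numbers at the ramified primes
`2, 3` (all other local factors are `1`). [cite: VignerasLNM800, Ch. III §5 Thm. 5.11, Cor. 5.12] [cite: Eichler1955, Satz 3–5] -/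
theorem card_throughClass_ordOf_eq_classNumber_mul {γ : ℍ[ℚ,((-1 : ℤ) : ℚ),((3 : ℤ) : ℚ)]} {t : ℤ} {n : ℕ} (Hg : GammaHyp γ t n) {f : ℕ}
    (hf : f ∈ ellipticConductors t n) :
    Nat.card {q : ThroughClass (Submodule.span ℤ (Set.range ![(⟨1/2, 1/2, 1/2, -1/2⟩ : ℍ[ℚ,((-1 : ℤ) : ℚ),((3 : ℤ) : ℚ)]), ⟨0, 1, 0, 0⟩, ⟨0, 0, 1, 0⟩, ⟨0, 0, 0, 1⟩])) γ // optimalOrder q.rep γ = ordOf γ t n f} =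
      BinQF.classNumber (tOf t n f ^ 2 - 4 * nOf t n f) *
        (localEmbeddingNumber (Submodule.span ℤ (Set.range ![(⟨1/2, 1/2, 1/2, -1/2⟩ : ℍ[ℚ,((-1 : ℤ) : ℚ),((3 : ℤ) : ℚ)]), ⟨0, 1, 0, 0⟩, ⟨0, 0, 1, 0⟩, ⟨0, 0, 0, 1⟩])) γ (ordOf γ t n f) 2 * localEmbeddingNumber (Submodule.span ℤ (Set.range ![(⟨1/2, 1/2, 1/2, -1/2⟩ : ℍ[ℚ,((-1 : ℤ) : ℚ),((3 : ℤ) : ℚ)]), ⟨0, 1, 0, 0⟩, ⟨0, 0, 1, 0⟩, ⟨0, 0, 0, 1⟩])) γ (ordOf γ t n f) 3) := by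
  classical
  haveI := isQuaternionAlgebra_neg_one_three
  have hO : IsOrder ℍ[ℚ,((-1 : ℤ) : ℚ),((3 : ℤ) : ℚ)] (Submodule.span ℤ (Set.range ![(⟨1/2, 1/2, 1/2, -1/2⟩ : ℍ[ℚ,((-1 : ℤ) : ℚ),((3 : ℤ) : ℚ)]), ⟨0, 1, 0, 0⟩, ⟨0, 0, 1, 0⟩, ⟨0, 0, 0, 1⟩])) := isOrder_maxOrderLattice
  have hB := Hg.isQuadOrder_ordOf hf
  obtain ⟨S₁, hS₁, hS₁'⟩ := exists_finset_optimalOrder_localAt_eq hO hB (O := (Submodule.span ℤ (Set.range ![(⟨1/2, 1/2, 1/2, -1/2⟩ : ℍ[ℚ,((-1 : ℤ) : ℚ),((3 : ℤ) : ℚ)]), ⟨0, 1, 0, 0⟩, ⟨0, 0, 1, 0⟩, ⟨0, 0, 0, 1⟩])))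
  set S₀ : Finset ℕ := {2, 3} ∪ S₁ with hS₀
  have h2 : (2 : ℕ) ∈ S₀ := Finset.mem_union_left _ (by simp)
  have h3 : (3 : ℕ) ∈ S₀ := Finset.mem_union_left _ (by simp)
  have hS₀p : ∀ q ∈ S₀, q.Prime := by
    intro q hq
    rcases Finset.mem_union.mp hq with h | h
    · simp only [Finset.mem_insert, Finset.mem_singleton] at h
      rcases h with rfl | rfl
      · exact Nat.prime_two
      · exact Nat.prime_three
    · exact hS₁ q h
  have h0 : ∀ q : ℕ, q.Prime → q ∉ S₀ → optimalOrder (localAt q (Submodule.span ℤ (Set.range ![(⟨1/2, 1/2, 1/2, -1/2⟩ : ℍ[ℚ,((-1 : ℤ) : ℚ),((3 : ℤ) : ℚ)]), ⟨0, 1, 0, 0⟩, ⟨0, 0, 1, 0⟩, ⟨0, 0, 0, 1⟩]))) γ = localAt q (ordOf γ t n f) :=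
    fun q hq hqS => hS₁' q hq fun h => hqS (Finset.mem_union_right _ h)
  have h1 : ∀ q : ℕ, q.Prime → q ∉ S₀ → ∀ L ∈ localIdeals (Submodule.span ℤ (Set.range ![(⟨1/2, 1/2, 1/2, -1/2⟩ : ℍ[ℚ,((-1 : ℤ) : ℚ),((3 : ℤ) : ℚ)]), ⟨0, 1, 0, 0⟩, ⟨0, 0, 1, 0⟩, ⟨0, 0, 0, 1⟩])) γ (ordOf γ t n f) q,
      ∃ c : (ℍ[ℚ,((-1 : ℤ) : ℚ),((3 : ℤ) : ℚ)])ˣ, (c : ℍ[ℚ,((-1 : ℤ) : ℚ),((3 : ℤ) : ℚ)]) * γ = γ * c ∧ L = c • localAt q (Submodule.span ℤ (Set.range ![(⟨1/2, 1/2, 1/2, -1/2⟩ : ℍ[ℚ,((-1 : ℤ) : ℚ),((3 : ℤ) : ℚ)]), ⟨0, 1, 0, 0⟩, ⟨0, 0, 1, 0⟩, ⟨0, 0, 0, 1⟩])) := by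
    intro q hq hqS L hL
    haveI := Fact.mk hq
    exact exists_eq_smul_localAt_maxOrderLattice_of_not_dvd_six (not_dvd_six_of_not_mem₆₅ h2 h3 hq hqS) Hg.hγ
      (h0 q hq hqS) hL
  rw [card_throughClass_optimalOrder_eq_of_isUnit forall_isUnit_neg_one_three hO Hg.hγ hB S₀ hS₀p h0 h1]
  -- the product over `S₀`: factors `1` outside `{2, 3}`
  have hsplit : S₀ = {2, 3} ∪ (S₁ \ {2, 3}) := by
    rw [hS₀, Finset.union_sdiff_self_eq_union]
  have hone : ∀ q ∈ S₁ \ {2, 3}, localEmbeddingNumber (Submodule.span ℤ (Set.range ![(⟨1/2, 1/2, 1/2, -1/2⟩ : ℍ[ℚ,((-1 : ℤ) : ℚ),((3 : ℤ) : ℚ)]), ⟨0, 1, 0, 0⟩, ⟨0, 0, 1, 0⟩, ⟨0, 0, 0, 1⟩])) γ (ordOf γ t n f) q = 1 := by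
    intro q hq
    rw [Finset.mem_sdiff] at hq
    have hqp : q.Prime := hS₁ q hq.1
    haveI := Fact.mk hqp
    have hnd : ¬ q ∣ 6 := not_dvd_six_of_not_mem₆₅ (P := ({2, 3} : Finset ℕ)) (by simp) (by simp) hqp hq.2
    exact localEmbeddingNumber_maxOrderLattice_eq_one_of_not_dvd_six hnd Hg.hγ hB
  rw [hsplit, Finset.prod_union Finset.disjoint_sdiff, Finset.prod_eq_one hone, mul_one,
    Finset.prod_pair (by norm_num), Hg.classNumber_ordOf hf]

/-- **Eichler's formula for `O₆`, explicit local factors**: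
`#{[J] : O_L(J) ∩ ℚ(γ) = B_f} = h(t_f² − 4n_f) · m₂(f) · m₃(f)` with
`m_p(f) = brFactorRam p t n f = [fp not a conductor] · (2 − ρ_p(t_f, n_f))`. [cite: VignerasLNM800, Ch. III §5 Thm. 5.11, Cor. 5.12, Exercice 5.2] [cite: Eichler1955, Satz 5] -/
theorem card_throughClass_ordOf_eq_classNumber_mul_brFactorRam {γ : ℍ[ℚ,((-1 : ℤ) : ℚ),((3 : ℤ) : ℚ)]} {t : ℤ} {n : ℕ} (Hg : GammaHyp γ t n)
    {f : ℕ} (hf : f ∈ ellipticConductors t n) :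
    (Nat.card {q : ThroughClass (Submodule.span ℤ (Set.range ![(⟨1/2, 1/2, 1/2, -1/2⟩ : ℍ[ℚ,((-1 : ℤ) : ℚ),((3 : ℤ) : ℚ)]), ⟨0, 1, 0, 0⟩, ⟨0, 0, 1, 0⟩, ⟨0, 0, 0, 1⟩])) γ // optimalOrder q.rep γ = ordOf γ t n f} : ℚ) =
      BinQF.classNumber (tOf t n f ^ 2 - 4 * nOf t n f) * (brFactorRam 2 t n f * brFactorRam 3 t n f) := by
  rw [card_throughClass_ordOf_eq_classNumber_mul Hg hf, Nat.cast_mul, Nat.cast_mul,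
    localEmbeddingNumber_maxOrderLattice_ordOf_eq_brFactorRam Nat.prime_two (by norm_num) Hg hf,
    localEmbeddingNumber_maxOrderLattice_ordOf_eq_brFactorRam Nat.prime_three (by norm_num) Hg hf]

end Eichler

/-! ## §3 The embedding criterion: `ℚ(√(t² − 4n)) ↪ B` unless `t² − 4n` is a square in `ℚ₂` or `ℚ₃` -/

section Embedding

/-- An element with `x² = Δ`, `Δ < 0`, has `trd x = 0` and `nrd x = −Δ`. [folklore] -/
private theorem reducedTrace_eq_zero_of_sq₆₅ {Δ : ℚ} (hΔ : Δ < 0) {x : ℍ[ℚ,((-1 : ℤ) : ℚ),((3 : ℤ) : ℚ)]} (hx : x * x = algebraMap ℚ ℍ[ℚ,((-1 : ℤ) : ℚ),((3 : ℤ) : ℚ)] Δ) :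
    reducedTrace ℚ ℍ[ℚ,((-1 : ℤ) : ℚ),((3 : ℤ) : ℚ)] x = 0 ∧ reducedNorm ℚ ℍ[ℚ,((-1 : ℤ) : ℚ),((3 : ℤ) : ℚ)] x = -Δ := by
  haveI := isQuaternionAlgebra_neg_one_three
  haveI : Nontrivial ℍ[ℚ,((-1 : ℤ) : ℚ),((3 : ℤ) : ℚ)] := nontrivial_of_isQuaternionAlgebra
  have h := mul_self_eq_reducedTrace_mul_sub_reducedNorm ℚ ℍ[ℚ,((-1 : ℤ) : ℚ),((3 : ℤ) : ℚ)] x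
  rw [hx] at h
  have h1 : algebraMap ℚ ℍ[ℚ,((-1 : ℤ) : ℚ),((3 : ℤ) : ℚ)] (reducedTrace ℚ ℍ[ℚ,((-1 : ℤ) : ℚ),((3 : ℤ) : ℚ)] x) * x = algebraMap ℚ ℍ[ℚ,((-1 : ℤ) : ℚ),((3 : ℤ) : ℚ)] (Δ + reducedNorm ℚ ℍ[ℚ,((-1 : ℤ) : ℚ),((3 : ℤ) : ℚ)] x) := by
    rw [map_add, h]; abel
  by_cases htr : reducedTrace ℚ ℍ[ℚ,((-1 : ℤ) : ℚ),((3 : ℤ) : ℚ)] x = 0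
  · refine ⟨htr, ?_⟩
    rw [htr, map_zero, zero_mul, eq_comm, map_eq_zero_iff _ (algebraMap ℚ ℍ[ℚ,((-1 : ℤ) : ℚ),((3 : ℤ) : ℚ)]).injective] at h1
    linarith
  · exfalso
    have hxc : x = algebraMap ℚ ℍ[ℚ,((-1 : ℤ) : ℚ),((3 : ℤ) : ℚ)] ((reducedTrace ℚ ℍ[ℚ,((-1 : ℤ) : ℚ),((3 : ℤ) : ℚ)] x)⁻¹ * (Δ + reducedNorm ℚ ℍ[ℚ,((-1 : ℤ) : ℚ),((3 : ℤ) : ℚ)] x)) := by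
      rw [map_mul, ← h1, ← mul_assoc, ← map_mul, inv_mul_cancel₀ htr, map_one, one_mul]
    set c := (reducedTrace ℚ ℍ[ℚ,((-1 : ℤ) : ℚ),((3 : ℤ) : ℚ)] x)⁻¹ * (Δ + reducedNorm ℚ ℍ[ℚ,((-1 : ℤ) : ℚ),((3 : ℤ) : ℚ)] x)
    have : c * c = Δ := by
      have e := hx
      rw [hxc, ← map_mul] at e
      exact (algebraMap ℚ ℍ[ℚ,((-1 : ℤ) : ℚ),((3 : ℤ) : ℚ)]).injective e
    nlinarith [mul_self_nonneg c]

/-- From `x² = t² − 4n` to an element of trace `t` and norm `n`: `y = (t + x)/2`. [folklore] -/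
private theorem exists_trace_norm_of_sq₆₅ {t : ℤ} {n : ℕ} (h : t ^ 2 < 4 * n) {x : ℍ[ℚ,((-1 : ℤ) : ℚ),((3 : ℤ) : ℚ)]}
    (hx : x * x = algebraMap ℚ ℍ[ℚ,((-1 : ℤ) : ℚ),((3 : ℤ) : ℚ)] ((t : ℚ) ^ 2 - 4 * n)) :
    ∃ y : ℍ[ℚ,((-1 : ℤ) : ℚ),((3 : ℤ) : ℚ)], reducedTrace ℚ ℍ[ℚ,((-1 : ℤ) : ℚ),((3 : ℤ) : ℚ)] y = t ∧ reducedNorm ℚ ℍ[ℚ,((-1 : ℤ) : ℚ),((3 : ℤ) : ℚ)] y = n := by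
  haveI := isQuaternionAlgebra_neg_one_three
  have hΔ : ((t : ℚ)) ^ 2 - 4 * n < 0 := by exact_mod_cast (by linarith : (t ^ 2 - 4 * n : ℤ) < 0)
  obtain ⟨htr, hnr⟩ := reducedTrace_eq_zero_of_sq₆₅ hΔ hx
  refine ⟨algebraMap ℚ ℍ[ℚ,((-1 : ℤ) : ℚ),((3 : ℤ) : ℚ)] ((t : ℚ) / 2) + (1 / 2 : ℚ) • x, ?_, ?_⟩
  · rw [reducedTrace_ratCoords, htr]; ring
  · rw [reducedNorm_ratCoords, htr, hnr]; ring

/-- **Vignéras III.3.8 for `B = (−1,3)_ℚ`**: if `t² − 4n < 0` is a square neither in `ℚ₂` nor in `ℚ₃` (the ramified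
places of `B`; at `∞` a negative number is never a square), then `ℚ(√(t² − 4n))` embeds in `B`: some `y ∈ B` has
`trd y = t`, `nrd y = n`. [cite: VignerasLNM800, Ch. III §3 Thm. 3.8] -/
theorem exists_trace_norm_of_not_isSquare_two_three {t : ℤ} {n : ℕ} (h : t ^ 2 < 4 * n)
    (h₂ : ¬ IsSquare ((((t : ℚ) ^ 2 - 4 * n : ℚ)) : ℚ_[2])) (h₃ : ¬ IsSquare ((((t : ℚ) ^ 2 - 4 * n : ℚ)) : ℚ_[3])) :
    ∃ y : ℍ[ℚ,((-1 : ℤ) : ℚ),((3 : ℤ) : ℚ)], reducedTrace ℚ ℍ[ℚ,((-1 : ℤ) : ℚ),((3 : ℤ) : ℚ)] y = t ∧ reducedNorm ℚ ℍ[ℚ,((-1 : ℤ) : ℚ),((3 : ℤ) : ℚ)] y = n := by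
  haveI := isQuaternionAlgebra_neg_one_three
  have hΔ : ((t : ℚ)) ^ 2 - 4 * n < 0 := by exact_mod_cast (by linarith : (t ^ 2 - 4 * n : ℤ) < 0)
  set Δ : ℚ := (t : ℚ) ^ 2 - 4 * n with hΔdef
  have h1 : ¬ IsSquare Δ := by
    rintro ⟨u, hu⟩; nlinarith [mul_self_nonneg u]
  have h2 : ∀ v ∈ ramifiedPlaces ℚ ℍ[ℚ,((-1 : ℤ) : ℚ),((3 : ℤ) : ℚ)], ¬ IsSquare (algebraMap ℚ (v.adicCompletion ℚ) Δ) := by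
    intro v hv hsqv
    have hv' : ¬ IsSplitAt ℍ[ℚ,((-1 : ℤ) : ℚ),((3 : ℤ) : ℚ)] v := hv
    rw [isSplitAt_iff_not_dvd_six, not_not] at hv'
    -- `p_v ∈ {2, 3}`
    haveI : Fact (Nat.Prime ((Rat.HeightOneSpectrum.primesEquiv v : Nat.Primes) : ℕ)) :=
      ⟨(Rat.HeightOneSpectrum.primesEquiv v).2⟩
    let e := Rat.HeightOneSpectrum.adicCompletion.padicEquiv (R := 𝓞 ℚ) v
    have hsq' : IsSquare (algebraMap ℚ ℚ_[((Rat.HeightOneSpectrum.primesEquiv v : Nat.Primes) : ℕ)] Δ) := by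
      have := hsqv.map e.toAlgEquiv
      rwa [AlgEquiv.commutes] at this
    rcases eq_two_or_three_of_dvd_six₆₅ (Rat.HeightOneSpectrum.prime_natGenerator v) hv' with hp | hp
    · exact h₂ (isSquare_padic_of_eq (q := 2) hp hsq')
    · exact h₃ (isSquare_padic_of_eq (q := 3) hp hsq')
  have h3 : ∀ w ∈ ramifiedInfinitePlaces ℚ ℍ[ℚ,((-1 : ℤ) : ℚ),((3 : ℤ) : ℚ)], ¬ IsSquare (algebraMap ℚ w.Completion Δ) := by
    intro w _ hsqw
    have hw : w.IsReal := NumberField.IsTotallyReal.isReal w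
    let ψ := NumberField.InfinitePlace.Completion.extensionEmbeddingOfIsReal hw
    have := hsqw.map ψ
    rw [show ψ (algebraMap ℚ w.Completion Δ) = (Δ : ℝ) from eq_ratCast (ψ.comp (algebraMap ℚ w.Completion)) Δ] at this
    obtain ⟨u, hu⟩ := this
    have : (Δ : ℝ) < 0 := by exact_mod_cast hΔ
    nlinarith [mul_self_nonneg u]
  obtain ⟨x, hx⟩ := exists_sq_eq_of_not_isSquare_ramified_holds ℚ ℍ[ℚ,((-1 : ℤ) : ℚ),((3 : ℤ) : ℚ)] Δ h1 h2 h3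
  exact exists_trace_norm_of_sq₆₅ h hx

/-- If `t² − 4n` is a `p`-adic square then `m_p(B_f) = 0` for every conductor `f` (`B_f` maximal at `p` ⇒ `p` splits
in `ℚ(γ)` ⇒ `ρ_p = 2`). [cite: VignerasLNM800, Ch. II §3] -/
private theorem brFactorRam_eq_zero_of_isSquare₆₅ {p : ℕ} [hp : Fact p.Prime] {t : ℤ} {n : ℕ} (h : t ^ 2 < 4 * n)
    {f : ℕ} (hf : f ∈ ellipticConductors t n) (hsq : IsSquare ((((t : ℚ) ^ 2 - 4 * n : ℚ)) : ℚ_[p])) :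
    brFactorRam p t n f = 0 := by
  unfold brFactorRam
  split_ifs with hfp
  · rfl
  · suffices hρ : Brandt.rho p (tOf t n f) (nOf t n f) = 2 by rw [hρ]; norm_num
    apply rho_eq_two_of_isSquare_padic
    · rwa [nonmax_iff h hp.out hf]
    · have hf0 : (f : ℚ_[p]) ≠ 0 := by exact_mod_cast (pos_of_mem_ellipticConductors h hf).ne'
      have e : (((tOf t n f ^ 2 - 4 * nOf t n f : ℤ)) : ℚ_[p]) =
          ((f : ℚ_[p]))⁻¹ ^ 2 * ((((t : ℚ) ^ 2 - 4 * n : ℚ)) : ℚ_[p]) := by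
        have := sq_mul_disc h hf
        have e' : (((t ^ 2 - 4 * n : ℤ)) : ℚ_[p]) =
            ((f : ℚ_[p])) ^ 2 * (((tOf t n f ^ 2 - 4 * nOf t n f : ℤ)) : ℚ_[p]) := by
          rw [← this]; push_cast; ring
        push_cast at e' ⊢
        rw [e']; field_simp
      rw [e]
      exact (IsSquare.sq _).mul hsq

/-- **If `(t, n)` is not realised in `B` (no `x ∈ B` with `trd x = t`, `nrd x = n`, `t² < 4n`) then
`m₂(B_f) · m₃(B_f) = 0` for every conductor `f`**: by III.3.8, `t² − 4n` is then a square in `ℚ₂` or in `ℚ₃`, and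
at that prime `B_f` is either non-maximal (`m_p = 0`) or maximal and split (`ρ_p = 2`, `m_p = 0`).
[cite: VignerasLNM800, Ch. III §3 Thm. 3.8; Ch. II §3] -/
theorem brFactorRam_two_mul_three_eq_zero_of_forall {t : ℤ} {n : ℕ} (h : t ^ 2 < 4 * n)
    (hno : ∀ x : ℍ[ℚ,((-1 : ℤ) : ℚ),((3 : ℤ) : ℚ)], reducedTrace ℚ ℍ[ℚ,((-1 : ℤ) : ℚ),((3 : ℤ) : ℚ)] x = t → reducedNorm ℚ ℍ[ℚ,((-1 : ℤ) : ℚ),((3 : ℤ) : ℚ)] x ≠ n) {f : ℕ}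
    (hf : f ∈ ellipticConductors t n) : brFactorRam 2 t n f * brFactorRam 3 t n f = 0 := by
  by_cases h₂ : IsSquare ((((t : ℚ) ^ 2 - 4 * n : ℚ)) : ℚ_[2])
  · rw [brFactorRam_eq_zero_of_isSquare₆₅ h hf h₂, zero_mul]
  by_cases h₃ : IsSquare ((((t : ℚ) ^ 2 - 4 * n : ℚ)) : ℚ_[3])
  · rw [brFactorRam_eq_zero_of_isSquare₆₅ h hf h₃, mul_zero]
  exfalso
  obtain ⟨y, hy1, hy2⟩ := exists_trace_norm_of_not_isSquare_two_three h h₂ h₃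
  exact hno y hy1 hy2

end Embedding

/-! ## §4 `P(m) = |L_prim(m)/O₆^×| = h(disc S_m) · m₂ · m₃` for every `m > 0` -/

section Primitive

/-- `1` resp. `2` is the bottom conductor `f₁`: it is a conductor of `(0, m)`. [cite: Cox2013, §7.A Lemma 7.2] -/
theorem f₁_mem_ellipticConductors {m : ℕ} (hm : 0 < m) : (if (m : ℤ) % 4 = 3 then 2 else 1) ∈ ellipticConductors 0 m := by
  split_ifs with h3
  · exact two_mem_ellipticConductors_of_emod_four hm h3
  · exact one_mem_ellipticConductors (by positivity)

/-- **`P(m) = h(disc S_m) · m₂(S_m) · m₃(S_m)` for EVERY `m > 0`** — Eichler's count of the `O₆^×`-classes of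
PRIMITIVE special vectors of norm `m` (the optimal embeddings `S_m ↪ O₆` of the order `S_m = B_{f₁}`:
`ℤ[√−m]`, discriminant `−4m`, if `m ≢ 3 (mod 4)`; `ℤ[(1+√−m)/2]`, discriminant `−m`, if `m ≡ 3 (mod 4)`), with
`m_p(S_m) = brFactorRam p 0 m f₁ = [S_m maximal at p] · (1 − (S_m/p))` at the ramified primes `p = 2, 3`. When no pure
element of norm `m` exists in `B` both sides vanish (§3). [cite: VignerasLNM800, Ch. III §5 Thm. 5.11, Cor. 5.12–5.14] [cite: Eichler1955, Satz 5] [cite: KudlaRapoportYang2006, §3.4 (3.4.6) and (3.4.13)] -/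
theorem card_primitive_classes_eq_classNumber_mul_brFactorRam {m : ℕ} (hm : 0 < m) :
    (Nat.card (Quot (fun x y : {x : ℤ × ℤ × ℤ // x.1 ^ 2 - 3 * x.2.1 ^ 2 - 3 * x.2.2 ^ 2 = (m : ℤ) ∧
      ∃ u : ℤ × ℤ × ℤ, u.1 * x.1 + u.2.1 * x.2.1 + u.2.2 * x.2.2 = 1} ↦
      ∃ v : ℍ[ℚ,((-1 : ℤ) : ℚ),((3 : ℤ) : ℚ)], (v ∈ order (-1) 3 ∨ v - ⟨1/2, 1/2, 1/2, -1/2⟩ ∈ order (-1) 3) ∧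
        ((v * star v).re = 1 ∨ (v * star v).re = -1) ∧
        v * ⟨0, x.1.1, x.1.2.1, x.1.2.2⟩ = ⟨0, y.1.1, y.1.2.1, y.1.2.2⟩ * v)) : ℚ) =
      BinQF.classNumber (tOf 0 m (if (m : ℤ) % 4 = 3 then 2 else 1) ^ 2 - 4 * nOf 0 m (if (m : ℤ) % 4 = 3 then 2 else 1)) *
        (brFactorRam 2 0 m (if (m : ℤ) % 4 = 3 then 2 else 1) * brFactorRam 3 0 m (if (m : ℤ) % 4 = 3 then 2 else 1)) := by
  by_cases hex : ∃ γ : ℍ[ℚ,((-1 : ℤ) : ℚ),((3 : ℤ) : ℚ)], γ.re = 0 ∧ (γ * star γ).re = m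
  · obtain ⟨γ, hγ0, hγm⟩ := hex
    have hγne : γ ≠ 0 := by
      rintro rfl
      simp only [zero_mul, QuaternionAlgebra.re_zero] at hγm
      exact hm.ne' (by exact_mod_cast hγm.symm)
    have hγ : γ ∉ (⊥ : Subalgebra ℚ ℍ[ℚ,((-1 : ℤ) : ℚ),((3 : ℤ) : ℚ)]) := not_mem_bot_of_re_eq_zero hγ0 hγne
    have hγm' : (γ * star γ).re = ((m : ℕ) : ℤ) := by rw [hγm, Int.cast_natCast]
    rw [← card_throughClass_ordOf_eq_card_primitive_classes hγ hγ0 hm hγm',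
      card_throughClass_ordOf_eq_classNumber_mul_brFactorRam (gammaHyp_of_pure hγ0 hm hγm)
        (f₁_mem_ellipticConductors hm)]
  · -- no pure element of norm `m`: `L(m) = ∅` and `m₂ m₃ = 0`
    have hE : IsEmpty (Quot (fun x y : {x : ℤ × ℤ × ℤ // x.1 ^ 2 - 3 * x.2.1 ^ 2 - 3 * x.2.2 ^ 2 = (m : ℤ) ∧
      ∃ u : ℤ × ℤ × ℤ, u.1 * x.1 + u.2.1 * x.2.1 + u.2.2 * x.2.2 = 1} ↦
      ∃ v : ℍ[ℚ,((-1 : ℤ) : ℚ),((3 : ℤ) : ℚ)], (v ∈ order (-1) 3 ∨ v - ⟨1/2, 1/2, 1/2, -1/2⟩ ∈ order (-1) 3) ∧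
        ((v * star v).re = 1 ∨ (v * star v).re = -1) ∧
        v * ⟨0, x.1.1, x.1.2.1, x.1.2.2⟩ = ⟨0, y.1.1, y.1.2.1, y.1.2.2⟩ * v)) := by
      refine ⟨fun q => Quot.inductionOn q fun y => hex ⟨⟨0, y.1.1, y.1.2.1, y.1.2.2⟩, rfl, ?_⟩⟩
      rw [re_mul_star_eq_coords]
      have h' : ((y.1.1 : ℤ) : ℚ) ^ 2 - 3 * ((y.1.2.1 : ℤ) : ℚ) ^ 2 - 3 * ((y.1.2.2 : ℤ) : ℚ) ^ 2 = ((m : ℤ) : ℚ) := by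
        exact_mod_cast y.2.1
      show (0 : ℚ) ^ 2 + (y.1.1 : ℚ) ^ 2 - 3 * (y.1.2.1 : ℚ) ^ 2 - 3 * (y.1.2.2 : ℚ) ^ 2 = (m : ℕ)
      rw [Int.cast_natCast] at h'
      linear_combination h'
    have hno : ∀ x : ℍ[ℚ,((-1 : ℤ) : ℚ),((3 : ℤ) : ℚ)], reducedTrace ℚ ℍ[ℚ,((-1 : ℤ) : ℚ),((3 : ℤ) : ℚ)] x = (0 : ℤ) → reducedNorm ℚ ℍ[ℚ,((-1 : ℤ) : ℚ),((3 : ℤ) : ℚ)] x ≠ m := by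
      intro x hx hn
      rw [reducedTrace_eq_two_mul_re, Int.cast_zero] at hx
      rw [reducedNorm_eq_re_mul_star] at hn
      exact hex ⟨x, by linarith, hn⟩
    rw [Nat.card_of_isEmpty, Nat.cast_zero,
      brFactorRam_two_mul_three_eq_zero_of_forall (by positivity) hno (f₁_mem_ellipticConductors hm), mul_zero]

/-- The same with the discriminant made explicit: `disc S_m = −m` if `m ≡ 3 (mod 4)` and `−4m` otherwise
(`t_f² − 4n_f = (0² − 4m)/f₁²`). [cite: Cox2013, §7.A (7.3)] [cite: KudlaRapoportYang2006, §3.4 (3.4.6)] -/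
theorem card_primitive_classes_eq_classNumber_disc_mul_brFactorRam {m : ℕ} (hm : 0 < m) :
    (Nat.card (Quot (fun x y : {x : ℤ × ℤ × ℤ // x.1 ^ 2 - 3 * x.2.1 ^ 2 - 3 * x.2.2 ^ 2 = (m : ℤ) ∧
      ∃ u : ℤ × ℤ × ℤ, u.1 * x.1 + u.2.1 * x.2.1 + u.2.2 * x.2.2 = 1} ↦
      ∃ v : ℍ[ℚ,((-1 : ℤ) : ℚ),((3 : ℤ) : ℚ)], (v ∈ order (-1) 3 ∨ v - ⟨1/2, 1/2, 1/2, -1/2⟩ ∈ order (-1) 3) ∧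
        ((v * star v).re = 1 ∨ (v * star v).re = -1) ∧
        v * ⟨0, x.1.1, x.1.2.1, x.1.2.2⟩ = ⟨0, y.1.1, y.1.2.1, y.1.2.2⟩ * v)) : ℚ) =
      BinQF.classNumber (if (m : ℤ) % 4 = 3 then -(m : ℤ) else -4 * m) *
        (brFactorRam 2 0 m (if (m : ℤ) % 4 = 3 then 2 else 1) * brFactorRam 3 0 m (if (m : ℤ) % 4 = 3 then 2 else 1)) := by
  rw [card_primitive_classes_eq_classNumber_mul_brFactorRam hm,
    ← disc_div_sq (by positivity) (f₁_mem_ellipticConductors hm)]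
  congr 3
  split_ifs with h3
  · push_cast
    omega
  · push_cast
    omega

end Primitive

/-! ## §5 All `t`: `|L(t)/O₆^×| = Σ_{c² ∣ t} h(disc S_{t/c²}) · m₂ · m₃` -/

section AllT

/-- **`|L(t)/O₆^×| = Σ_{c² ∣ t} h(disc S_{t/c²}) · m₂(S_{t/c²}) · m₃(S_{t/c²})` for every `t > 0`** — the number of
`O₆^×`-classes of special vectors of norm `t` (the index set of KRY (3.4.13), whose weighted count is `deg Z(t)`) as
the sum over the orders `S_{t/c²} ⊃ ℤ[√−t]` of Eichler's optimal-embedding numbers (KRY (3.4.6); Vignéras III.5.14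
`Σ_B h(B) ∏ m_p(B)`). [cite: KudlaRapoportYang2006, §3.4 (3.4.6), (3.4.13) and Remark 3.4.7] [cite: VignerasLNM800, Ch. III §5 Cor. 5.14] [cite: Eichler1955, Satz 5] -/
theorem card_unit_classes_eq_sum_classNumber_mul_brFactorRam {T : ℤ} (hT : 0 < T) :
    (Nat.card (Quot (fun x y : {x : ℤ × ℤ × ℤ // x.1 ^ 2 - 3 * x.2.1 ^ 2 - 3 * x.2.2 ^ 2 = T} ↦
      ∃ v : ℍ[ℚ,((-1 : ℤ) : ℚ),((3 : ℤ) : ℚ)], (v ∈ order (-1) 3 ∨ v - ⟨1/2, 1/2, 1/2, -1/2⟩ ∈ order (-1) 3) ∧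
        ((v * star v).re = 1 ∨ (v * star v).re = -1) ∧
        v * ⟨0, x.1.1, x.1.2.1, x.1.2.2⟩ = ⟨0, y.1.1, y.1.2.1, y.1.2.2⟩ * v)) : ℚ) =
      ∑ c ∈ (Finset.Icc 1 T.toNat).filter (fun c : ℕ ↦ (c : ℤ) ^ 2 ∣ T),
        (BinQF.classNumber (tOf 0 (T / (c : ℤ) ^ 2).toNat (if (T / (c : ℤ) ^ 2) % 4 = 3 then 2 else 1) ^ 2 - 4 * nOf 0 (T / (c : ℤ) ^ 2).toNat (if (T / (c : ℤ) ^ 2) % 4 = 3 then 2 else 1)) : ℚ) *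
          (brFactorRam 2 0 (T / (c : ℤ) ^ 2).toNat (if (T / (c : ℤ) ^ 2) % 4 = 3 then 2 else 1) * brFactorRam 3 0 (T / (c : ℤ) ^ 2).toNat (if (T / (c : ℤ) ^ 2) % 4 = 3 then 2 else 1)) := by
  rw [card_unit_classes_eq_sum_primitive hT, Nat.cast_sum]
  refine Finset.sum_congr rfl fun c hc => ?_
  rw [Finset.mem_filter, Finset.mem_Icc] at hc
  obtain ⟨⟨hc1, -⟩, k, hk⟩ := hc
  have hc0 : (c : ℤ) ^ 2 ≠ 0 := by positivity
  have hk0 : 0 < k := pos_of_mul_pos_right (by rw [← hk]; exact hT) (by positivity)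
  have hdiv : T / (c : ℤ) ^ 2 = k := by rw [hk, Int.mul_ediv_cancel_left _ hc0]
  rw [hdiv]
  have hm : 0 < k.toNat := by omega
  have key := card_primitive_classes_eq_classNumber_mul_brFactorRam hm
  rw [Int.toNat_of_nonneg hk0.le] at key
  exact key

end AllT

end Literature.Geometry.Kaehler.ComplexTorus.QuaternionType
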